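import Summits.CriticalPhenomena.PercolationContinuityZ3.Theorems.Transplant.Slab111HubLegs
import HarnessLib

/-!
# The HUB ROUTING of the `(111)`-films, III: routing 1 (`P₁ = leg₁ · F₁[e₁ → d] · H_D · F₂ · leg₂`, branch `H_A · F₃ · leg₃`)

builds on p205010 (kernel theorem, internal audit signed; external expert review pending) — NOT used in this file.  Lane `prim-bschramm`, seat
`prim-bschramm-p2` (gen 36; class C1b; memo `HOME/bschramm/P2-LATTICES.md` §130); helper file (`--supports stmt-CriticalPhenomena-4575 --as helper`).
From a `HubData` («Slab111HubData», «Slab111HubLegs») the FIRST routing of the swap pair: the rerouted path runs along the leg of `E₁`, the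
`F₁`-helix from `e₁` through `c, y` to `d`, the hub `H_D`, the `F₂`-helix to `e₂` and the leg of `E₂`; the attachment vertex is `c` with successor
`y`; the branch is `H_A`, the `F₃`-helix to `e₃`, the leg of `w'`.  **`HubData.route₁`**: a `VRouteData (film k) PR W E₁ E₂ w'` with `y = D.y` and
`b = H_A`. [cite: DuminilCopinSidoraviciusTassion2016, §2.3 (proof of Fact 2: the three disjoint paths γ_u, γ_v, γ_w in B_R(z))]
-/

noncomputable section

namespace Summit.CriticalPhenomena.PercolationContinuityZ3.Theorems.Transplant

open Literature.Probability.Percolation Literature.Probability.LatticeModels SimpleGraph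
open scoped Classical

namespace Slab111

namespace HubData

variable {k : ℕ} {z : Site 2} {c0 : ℤ} {W PR : Set (slab111 k)} {E₁ E₂ w' : slab111 k} (D : HubData k z c0 W PR E₁ E₂ w')

/-- The rerouted path of routing 1. [folklore] -/
def SP1 : List (slab111 k) := (D.leg₁ ++ D.S1.tail) ++ ((D.d :: D.HD :: D.S2 D.LD) ++ D.leg₂.tail).tail

/-- The branch of routing 1. [folklore] -/
def Br1 : List (slab111 k) := D.HA :: (D.S3 D.LA ++ D.leg₃.tail)

/-- `SP1` is a self-avoiding path `E₁ → E₂`. [folklore] -/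
theorem gSP1 : GPath (film k) D.SP1 E₁ E₂ := by
  have gT : GPath (film k) ((D.d :: D.HD :: D.S2 D.LD) ++ D.leg₂.tail) D.d E₂ :=
    D.gT1.trans D.hl2 fun v hv2 hvT => by
      rcases List.mem_cons.1 hvT with h | h
      · exact absurd (h ▸ D.cdy_S1.2.1) (D.l2_S1 v hv2)
      rcases List.mem_cons.1 h with h | h
      · exact absurd h (D.l2_hub D.isHub_D v hv2)
      · exact D.l2_S2 D.isHub_D v hv2 h
  have gH : GPath (film k) (D.leg₁ ++ D.S1.tail) E₁ D.d := D.hl1.trans D.gS1 fun v hvS hv1 => D.l1_S1 v hv1 hvS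
  exact gH.trans gT fun v hvT hvH => by
    rcases List.mem_append.1 hvT with hvT | hvT
    · rcases List.mem_cons.1 hvT with h | h
      · exact h
      rcases List.mem_cons.1 h with h | h
      · rcases List.mem_append.1 hvH with h' | h'
        · exact absurd h (D.l1_hub D.isHub_D _ h')
        · exact absurd (List.mem_of_mem_tail h') (h ▸ D.hub_S1 D.isHub_D)
      · rcases List.mem_append.1 hvH with h' | h'
        · exact absurd h (D.l1_S2 D.isHub_D v h')
        · exact absurd h (D.S1_S2 D.isHub_D v (List.mem_of_mem_tail h'))
    · have hv2 : v ∈ D.leg₂ := List.mem_of_mem_tail hvT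
      rcases List.mem_append.1 hvH with h' | h'
      · exact absurd hv2 (D.l12 v h')
      · exact absurd (List.mem_of_mem_tail h') (D.l2_S1 v hv2)

/-- `SP1` decomposed. [folklore] -/
theorem SP1_eq : D.SP1 = D.leg₁.dropLast ++ D.S1 ++ (D.HD :: D.S2 D.LD ++ D.leg₂.tail) := by
  rw [SP1, D.hl1.eq_dropLast_concat]
  have hs : D.S1 = D.e₁ :: D.S1.tail := D.gS1.eq_cons
  conv_rhs => rw [hs]
  simp [HubData.e₁]

/-- Membership in `SP1`. [folklore] -/
theorem mem_SP1 {v : slab111 k} (hv : v ∈ D.SP1) : v ∈ D.leg₁ ∨ v ∈ D.S1 ∨ v = D.HD ∨ v ∈ D.S2 D.LD ∨ v ∈ D.leg₂ := by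
  rw [SP1_eq] at hv
  rcases List.mem_append.1 hv with hv | hv
  · rcases List.mem_append.1 hv with h | h
    · exact Or.inl (List.mem_of_mem_dropLast h)
    · exact Or.inr (Or.inl h)
  · rcases List.mem_cons.1 hv with h | h
    · exact Or.inr (Or.inr (Or.inl h))
    rcases List.mem_append.1 h with h | h
    · exact Or.inr (Or.inr (Or.inr (Or.inl h)))
    · exact Or.inr (Or.inr (Or.inr (Or.inr (List.mem_of_mem_tail h))))

/-- The interior of `SP1` lies in `PR`. [folklore] -/
theorem SP1_PR : ∀ x ∈ D.SP1.tail.dropLast, x ∈ PR := by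
  intro x hx
  obtain ⟨hxm, hxE1, hxE2⟩ := D.gSP1.mem_interior hx
  rcases D.mem_SP1 hxm with h | h | h | h | h
  · exact D.l1_PR x h hxE1
  · exact D.S1_PR x h
  · exact h ▸ D.hHD
  · exact (D.S2_facts D.isHub_D).2.1 x h
  · exact D.l2_PR x h hxE2

/-- `c, y` are consecutive on `SP1`. [folklore] -/
theorem SP1_cy : ∃ l₁ l₂ : List (slab111 k), D.SP1 = l₁ ++ D.c :: D.y :: l₂ := by
  obtain ⟨sl₁, sl₂, h⟩ := D.S1_split
  exact ⟨D.leg₁.dropLast ++ sl₁, sl₂ ++ (D.HD :: D.S2 D.LD ++ D.leg₂.tail), by rw [SP1_eq, h]; simp⟩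

/-- `Br1` is a self-avoiding path `H_A → w'`. [folklore] -/
theorem gBr1 : GPath (film k) D.Br1 D.HA w' := by
  have g : GPath (film k) (D.S3 D.LA ++ D.leg₃.tail) (rideV k z c0 D.F3 (D.LA + D.d₃)) w' :=
    (D.S3_facts D.isHub_A).1.trans D.hl3 fun v hv3 hvS => D.l3_S3 D.isHub_A v hv3 hvS
  refine g.cons (D.adj_hub3 D.isHub_A) ?_
  intro h
  rcases List.mem_append.1 h with h | h
  · exact (D.S3_facts D.isHub_A).2.2.2.1 D.isHub_A h
  · exact D.l3_hub D.isHub_A _ (List.mem_of_mem_tail h) rfl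

/-- `Br1 ⊆ W`. [folklore] -/
theorem Br1_W : ∀ x ∈ D.Br1, x ∈ W := by
  intro x hx
  rcases List.mem_cons.1 hx with h | h
  · exact h ▸ D.hPRW D.hHA
  rcases List.mem_append.1 h with h | h
  · exact (D.S3_facts D.isHub_A).2.1 x h
  · exact D.l3_W x (List.mem_of_mem_tail h)

/-- `Br1` is off `SP1`. [folklore] -/
theorem Br1_off : ∀ x ∈ D.Br1, x ∉ D.SP1 := by
  intro x hx hxP
  have hx' : x = D.HA ∨ x ∈ D.S3 D.LA ∨ x ∈ D.leg₃ := by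
    rcases List.mem_cons.1 hx with h | h
    · exact Or.inl h
    rcases List.mem_append.1 h with h | h
    · exact Or.inr (Or.inl h)
    · exact Or.inr (Or.inr (List.mem_of_mem_tail h))
  rcases D.mem_SP1 hxP with hP | hP | hP | hP | hP
  · -- x ∈ leg₁
    rcases hx' with h | h | h
    · exact D.l1_hub D.isHub_A x hP h
    · exact D.l1_S3 D.isHub_A x hP h
    · exact D.l13 x hP h
  · -- x ∈ S1
    rcases hx' with h | h | h
    · exact D.hub_S1 D.isHub_A (by change D.HA ∈ D.S1; rw [← h]; exact hP)
    · exact D.S1_S3 D.isHub_A x hP h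
    · exact D.l3_S1 x h hP
  · -- x = HD
    rcases hx' with h | h | h
    · exact D.HA_ne_HD (h ▸ hP.symm).symm
    · exact (D.S3_facts D.isHub_A).2.2.2.1 D.isHub_D (by change D.HD ∈ D.S3 D.LA; rw [← hP]; exact h)
    · exact D.l3_hub D.isHub_D x h hP
  · -- x ∈ S2 LD
    rcases hx' with h | h | h
    · exact (D.S2_facts D.isHub_D).2.2.2.1 D.isHub_A (by change D.HA ∈ D.S2 D.LD; rw [← h]; exact hP)
    · exact D.S2_S3 D.isHub_D D.isHub_A x hP h
    · exact D.l3_S2 D.isHub_D x h hP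
  · -- x ∈ leg₂
    rcases hx' with h | h | h
    · exact D.l2_hub D.isHub_A x hP h
    · exact D.l2_S3 D.isHub_A x hP h
    · exact D.l23 x hP h

/-- **ROUTING 1** of the hub construction: attachment vertex `c`, successor `y`, branch head `H_A`.
[cite: DuminilCopinSidoraviciusTassion2016, §2.3 (proof of Fact 2: γ_u, γ_v, γ_w)] -/
def route₁ : VRouteData (film k) PR W E₁ E₂ w' :=
  VRouteData.ofPaths D.gSP1 D.hne D.SP1_PR D.SP1_cy D.gBr1 D.Br1_W D.adj_HA_c.symm D.Br1_off

/-- The successor of routing 1 is `y`. [folklore] -/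
@[simp] theorem route₁_y : D.route₁.y = D.y := VRouteData.ofPaths_y _ _ _ _ _ _ _ _

/-- The branch head of routing 1 is `H_A`. [folklore] -/
@[simp] theorem route₁_b : D.route₁.b = D.HA := VRouteData.ofPaths_b _ _ _ _ _ _ _ _

end HubData

end Slab111

end Summit.CriticalPhenomena.PercolationContinuityZ3.Theorems.Transplant

end
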